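import Summits.AtomisticToContinuum.HydrodynamicLimit.Theorems.MourreKoopmanChargesLinearToEntropyInBandDefsC
import Summits.AtomisticToContinuum.HydrodynamicLimit.Theorems.MourreKoopmanChargesLinearToEntropyInBandVisCoreNToolkitB
import Summits.AtomisticToContinuum.HydrodynamicLimit.Theorems.MourreKoopmanChargesLinearToEntropyInBandWindowClausePieces
import Summits.AtomisticToContinuum.HydrodynamicLimit.Theorems.ImplosionDichotomyHydroLimitInBandWindowBalance
import Summits.AtomisticToContinuum.HydrodynamicLimit.Theorems.BoltzmannGreenKubo.Negative.JointMeasurability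
import Literature.Analysis.FluidPDE.PassiveScalarProofs
import HarnessLib

/-!
# Route `MourreKoopmanCharges`, crux `LinearToEntropyInBand` (stmt-AtomisticToContinuum-17740), skeleton v8:
# stub 4a-ii, window Fubini for the time-POINTWISE true-law inputs (plan § 3)

Support file (`--supports stmt-AtomisticToContinuum-17740`; registered helper `stub_windowClauseFubini`; worker of lead
prover-line-…-17740-c5-0, wave 5; plan `work/stubs/WINDOWCLAUSE-PLAN.md` § 1 (3) C/D2, § 3 "window Fubini").

Two antecedents of the corrected stub 4a-ii are TIME-POINTWISE in expectation under the true law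
`P = localGibbsLaw σ a₀ u₀ θ₀ N (Φ N)` — `EnergyCurrentTailsBelow η` (cubic velocity tails above a level `M`, `∀ s ∈ [0,t]`
innermost) and `DenseKineticContentW η` (the `(1 + ‖v‖²)`-weighted content of the mesoscopically dense particles,
`∀ s ∈ [0,t]` innermost) —, whereas the chain consumes them integrated over a micro window `[s, s + w]` along the orbit
(terms C1, C2, D2 of the plan).  This file is the Tonelli step, in the pattern of the sibling heart's TM
`ClampedCurrentsDockThirdMoment.stub_thirdMomentWindow`, typed ONCE for an arbitrary measurable one-time functional `G`:

* § 1 `lintegral_ofReal_intervalIntegral_flow_le` — for a measure `P` carried by the good set of the flow (`P`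
  s-finite), a measurable `G : Config → ℝ` (no sign, no integrability: `ofReal ∫ ≤ ∫⁻ ofReal` always —
  `Literature.Analysis.FluidPDE.ofReal_integral_le_lintegral_ofReal` —, and the Bochner
  junk `0` of a non-integrable orbit integrand is harmless) and a pointwise-in-time bound
  `∀ r ∈ [s, s+w], ∫⁻ ofReal (G (Φ_r z)) dP ≤ B`, the window bound `∫⁻ ofReal (∫_s^{s+w} G(Φ_r z) dr) dP ≤ ofReal w · B`
  (joint measurability of `(r, z) ↦ G (Φ_r z)` through the flow modified off the good set,
  `BoltzmannGreenKuboOrthMomentum.measurable_flowMod`); `…_of_normalised` is the `(N+1)⁻¹`-normalised reading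
  `∀ r, E[(N+1)⁻¹ H ∘ Φ_r] ≤ ε ⇒ E[∫ H ∘ Φ_r dr] ≤ w (N+1) ε`.
* § 2 the two consumers' shapes under `P = localGibbsLaw …` (carried by the good set, `ae_mem_good_localGibbsLaw`):
  `ect_window_le` (the cubic tail functional of `EnergyCurrentTailsBelow` at any level `M`, accuracy `ε`) and
  `denseKineticContent_window_le` (the dense kinetic content with the FROZEN threshold `c · ρs(xᵢ)` of the chain, docked
  onto the time-dependent threshold `(5/4) ρ_r(xᵢ)` of `DenseKineticContentW` by `(5/4) ρ_r ≤ c ρs` on the window —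
  time-continuity of the Euler density, `5/4 < 3/2` — via the threshold monotonicity `ite_lt_le_ite_lt_of_le` of
  `…WindowClausePieces`).

Nothing here restates the crux, a stub, a neighbour's stub or the Statement; `EnergyCurrentTailsBelow` /
`DenseKineticContentW` are NOT assumed — only their inner inequality on one window is a hypothesis.  References: H.-T. Yau,
Lett. Math. Phys. 22 (1991) § 2; H. Spohn, *Large Scale Dynamics of Interacting Particles* (1991), Part I § 3.2.
-/

noncomputable section

open MeasureTheory Filter Set
open scoped ENNReal Topology InnerProductSpace BigOperators

namespace Summit.AtomisticToContinuum.HydrodynamicLimit.Theorems.LTEInBand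

open Literature.MathematicalPhysics.KineticTheory Literature.Analysis.FluidPDE Literature.Analysis.FunctionSpaces
open Summit.AtomisticToContinuum.HydrodynamicLimit.Theorems.BoltzmannGreenKuboOrthMomentum (flowMod measurable_flowMod flowMod_of_mem)
open Summit.AtomisticToContinuum.HydrodynamicLimit.Theorems.EntropyClockDock (ae_mem_good_localGibbsLaw)

/-! ## § 1 Tonelli over a window along the flow, for a pointwise-in-time bound -/

section General

variable {σ : ℝ} {N : ℕ}

/-- **Window Fubini for a time-pointwise bound in expectation.** For a measure `P` carried by the good set of the
hard-sphere flow `Φ`, a measurable one-time functional `G` and a window `[s, s + w]`: if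
`∫⁻ ofReal (G (Φ_r z)) dP ≤ B` at EVERY time `r` of the window, then `∫⁻ ofReal (∫_s^{s+w} G (Φ_r z) dr) dP ≤ ofReal w · B`
(Tonelli in `(r, z)` through the jointly measurable modified flow; no sign or integrability of `G` is needed). -/
theorem lintegral_ofReal_intervalIntegral_flow_le (Φ : HardSphereFlow (Torus.geometry (Fin 3)) (hsDiameter σ N) (N + 1))
    {P : Measure (Config (N + 1) (Fin 3) T3)} [SFinite P] (hgood : ∀ᵐ z ∂P, z ∈ Φ.good)
    {G : Config (N + 1) (Fin 3) T3 → ℝ} (hG : Measurable G) {s w : ℝ} (hw : 0 ≤ w) {B : ℝ≥0∞}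
    (hB : ∀ r ∈ Icc s (s + w), ∫⁻ z, ENNReal.ofReal (G (Φ.flow r z)) ∂P ≤ B) :
    ∫⁻ z, ENNReal.ofReal (∫ r in s..(s + w), G (Φ.flow r z)) ∂P ≤ ENNReal.ofReal w * B := by
  have hsw : s ≤ s + w := le_add_of_nonneg_right hw
  -- the jointly measurable integrand through the modified flow
  set F : Config (N + 1) (Fin 3) T3 × ℝ → ℝ≥0∞ := fun p => ENNReal.ofReal (G (flowMod Φ (p.2, p.1))) with hF
  have hFm : Measurable F := (hG.comp ((measurable_flowMod Φ).comp (measurable_snd.prodMk measurable_fst))).ennreal_ofReal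
  -- (1) the inner time integral is dominated by the lower integral of `F`, on the good set
  have h1 : ∀ᵐ z ∂P, ENNReal.ofReal (∫ r in s..(s + w), G (Φ.flow r z)) ≤ ∫⁻ r in Ioc s (s + w), F (z, r) := by
    filter_upwards [hgood] with z hz
    rw [intervalIntegral.integral_of_le hsw]
    refine (Literature.Analysis.FluidPDE.ofReal_integral_le_lintegral_ofReal _).trans_eq (lintegral_congr fun r => ?_)
    simp only [hF, flowMod_of_mem Φ hz]
  -- (2) Tonelli, (3) the pointwise-in-time bound, (4) the length of the window
  calc ∫⁻ z, ENNReal.ofReal (∫ r in s..(s + w), G (Φ.flow r z)) ∂P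
      ≤ ∫⁻ z, (∫⁻ r in Ioc s (s + w), F (z, r)) ∂P := lintegral_mono_ae h1
    _ = ∫⁻ r in Ioc s (s + w), ∫⁻ z, F (z, r) ∂P := lintegral_lintegral_swap hFm.aemeasurable
    _ ≤ ∫⁻ _r in Ioc s (s + w), B := by
        refine setLIntegral_mono' measurableSet_Ioc fun r hr => ?_
        calc ∫⁻ z, F (z, r) ∂P = ∫⁻ z, ENNReal.ofReal (G (Φ.flow r z)) ∂P := by
              refine lintegral_congr_ae ?_
              filter_upwards [hgood] with z hz
              simp only [hF, flowMod_of_mem Φ hz]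
          _ ≤ B := hB r ⟨hr.1.le, hr.2⟩
    _ = ENNReal.ofReal w * B := by
        rw [setLIntegral_const, Real.volume_Ioc, add_sub_cancel_left, mul_comm]

/-- **The `(N+1)⁻¹`-normalised reading** (the shape of the line's inputs): if `E_P[(N+1)⁻¹ H(Φ_r z)] ≤ ε` at every time
of the window (`ENNReal.ofReal` inside, `H` measurable, any sign), then `E_P[∫_s^{s+w} H(Φ_r z) dr] ≤ w (N+1) ε`. -/
theorem lintegral_ofReal_intervalIntegral_flow_le_of_normalised
    (Φ : HardSphereFlow (Torus.geometry (Fin 3)) (hsDiameter σ N) (N + 1))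
    {P : Measure (Config (N + 1) (Fin 3) T3)} [SFinite P] (hgood : ∀ᵐ z ∂P, z ∈ Φ.good)
    {H : Config (N + 1) (Fin 3) T3 → ℝ} (hH : Measurable H) {s w ε : ℝ} (hw : 0 ≤ w)
    (hB : ∀ r ∈ Icc s (s + w), ∫⁻ z, ENNReal.ofReal (((N : ℝ) + 1)⁻¹ * H (Φ.flow r z)) ∂P ≤ ENNReal.ofReal ε) :
    ∫⁻ z, ENNReal.ofReal (∫ r in s..(s + w), H (Φ.flow r z)) ∂P ≤ ENNReal.ofReal (w * ((N : ℝ) + 1) * ε) := by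
  have hN : (0 : ℝ) < (N : ℝ) + 1 := by positivity
  have hB' : ∀ r ∈ Icc s (s + w), ∫⁻ z, ENNReal.ofReal (H (Φ.flow r z)) ∂P ≤ ENNReal.ofReal (((N : ℝ) + 1) * ε) := by
    intro r hr
    have hsc : ∀ z, ENNReal.ofReal (H (Φ.flow r z)) =
        ENNReal.ofReal ((N : ℝ) + 1) * ENNReal.ofReal (((N : ℝ) + 1)⁻¹ * H (Φ.flow r z)) := fun z => by
      rw [← ENNReal.ofReal_mul hN.le, ← mul_assoc, mul_inv_cancel₀ hN.ne', one_mul]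
    calc ∫⁻ z, ENNReal.ofReal (H (Φ.flow r z)) ∂P
        = ENNReal.ofReal ((N : ℝ) + 1) * ∫⁻ z, ENNReal.ofReal (((N : ℝ) + 1)⁻¹ * H (Φ.flow r z)) ∂P := by
          rw [← lintegral_const_mul' _ _ ENNReal.ofReal_ne_top]
          exact lintegral_congr hsc
      _ ≤ ENNReal.ofReal ((N : ℝ) + 1) * ENNReal.ofReal ε := by gcongr; exact hB r hr
      _ = ENNReal.ofReal (((N : ℝ) + 1) * ε) := by rw [← ENNReal.ofReal_mul hN.le]
  calc ∫⁻ z, ENNReal.ofReal (∫ r in s..(s + w), H (Φ.flow r z)) ∂P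
      ≤ ENNReal.ofReal w * ENNReal.ofReal (((N : ℝ) + 1) * ε) :=
        lintegral_ofReal_intervalIntegral_flow_le Φ hgood hH hw hB'
    _ = ENNReal.ofReal (w * ((N : ℝ) + 1) * ε) := by rw [← ENNReal.ofReal_mul hw, mul_assoc]

end General

/-! ## § 2 The two consumers' shapes under the true law -/

section TrueLaw

variable {σ : ℝ} {N : ℕ} {a₀ θ₀ : T3 → ℝ} {u₀ : T3 → V3}

/-- `localGibbsLaw` is s-finite (a density against the s-finite Liouville volume of phase space, `localGibbsLaw_eq`;
a Prop-valued class, recorded as a theorem and installed locally with `haveI`). -/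
theorem sFinite_localGibbsLaw (Φ : HardSphereFlow (Torus.geometry (Fin 3)) (hsDiameter σ N) (N + 1)) :
    SFinite (localGibbsLaw σ a₀ u₀ θ₀ N Φ) := by
  haveI : SigmaFinite (volume : Measure (T3 × V3)) := inferInstance
  haveI : SigmaFinite (volume : Measure (Config (N + 1) (Fin 3) T3)) := inferInstance
  rw [localGibbsLaw_eq, localGibbsMeasure]
  infer_instance

/-- **ECT over a window.** Under `P = localGibbsLaw σ a₀ u₀ θ₀ N Φ`, the per-time cubic tail bound of
`EnergyCurrentTailsBelow` at level `M` and accuracy `ε` on `[s, s + w]`,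
`∀ r, E_P[(N+1)⁻¹ Σᵢ 𝟙{M < ‖vᵢ(r)‖} ‖vᵢ(r)‖³] ≤ ε`, gives the window bound
`E_P[∫_s^{s+w} Σᵢ 𝟙{M < ‖vᵢ(r)‖} ‖vᵢ(r)‖³ dr] ≤ w (N+1) ε` (term C1 / D2-fast of the plan, at level `M ≤ K − ‖u‖_∞`). -/
theorem ect_window_le (Φ : HardSphereFlow (Torus.geometry (Fin 3)) (hsDiameter σ N) (N + 1)) {M s w ε : ℝ}
    (hw : 0 ≤ w)
    (hECT : ∀ r ∈ Icc s (s + w), ∫⁻ z, ENNReal.ofReal (((N : ℝ) + 1)⁻¹ * ∑ i : Fin (N + 1),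
      Set.indicator {v : V3 | M < ‖v‖} (fun v => ‖v‖ ^ 3) ((Φ.flow r z i).2)) ∂(localGibbsLaw σ a₀ u₀ θ₀ N Φ) ≤
      ENNReal.ofReal ε) :
    ∫⁻ z, ENNReal.ofReal (∫ r in s..(s + w), ∑ i : Fin (N + 1),
        Set.indicator {v : V3 | M < ‖v‖} (fun v => ‖v‖ ^ 3) ((Φ.flow r z i).2)) ∂(localGibbsLaw σ a₀ u₀ θ₀ N Φ) ≤
      ENNReal.ofReal (w * ((N : ℝ) + 1) * ε) := by
  haveI := sFinite_localGibbsLaw (a₀ := a₀) (θ₀ := θ₀) (u₀ := u₀) Φ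
  have hH : Measurable fun y : Config (N + 1) (Fin 3) T3 =>
      ∑ i : Fin (N + 1), Set.indicator {v : V3 | M < ‖v‖} (fun v => ‖v‖ ^ 3) (y i).2 := by
    refine Finset.measurable_sum _ fun i _ => ?_
    exact ((measurable_norm.pow_const 3).indicator (measurableSet_lt measurable_const measurable_norm)).comp
      (measurable_pi_apply i).snd
  exact lintegral_ofReal_intervalIntegral_flow_le_of_normalised Φ (ae_mem_good_localGibbsLaw σ a₀ θ₀ u₀ N Φ) hH hw hECT

/-- **The dense kinetic content over a window, frozen threshold.** Under `P = localGibbsLaw σ a₀ u₀ θ₀ N Φ` and for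
measurable reference densities: if the per-time dense kinetic content of `DenseKineticContentW` (threshold
`(5/4) ρ_r(xᵢ)`, radius `R`) is `≤ η'` at every time of the window and `(5/4) ρ_r ≤ c ρs` pointwise on the window (in the
chain `c = 3/2`, `ρs = ρ_s`, by time-continuity of the Euler density), then the content with the FROZEN threshold
`c ρs(xᵢ)` satisfies `E_P[∫_s^{s+w} Σᵢ 𝟙{c ρs(xᵢ(r)) < (N+1)⁻¹ Σⱼ cone R N xᵢ(r) xⱼ(r)} (1 + ‖vᵢ(r)‖²) dr] ≤ w (N+1) η'`
(terms C2, D2-dense and the dense flips of D1 of the plan). -/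
theorem denseKineticContent_window_le (Φ : HardSphereFlow (Torus.geometry (Fin 3)) (hsDiameter σ N) (N + 1))
    {ρ : ℝ → T3 → ℝ} {ρs : T3 → ℝ} (hρsm : Measurable ρs) {c R s w η' : ℝ} (hw : 0 ≤ w) (hdock : ∀ r ∈ Icc s (s + w), ∀ y, 5 / 4 * ρ r y ≤ c * ρs y)
    (hDKC : ∀ r ∈ Icc s (s + w), ∫⁻ z, ENNReal.ofReal (((N : ℝ) + 1)⁻¹ * ∑ i : Fin (N + 1),
      (if 5 / 4 * ρ r ((Φ.flow r z i).1) < ((N : ℝ) + 1)⁻¹ * ∑ j : Fin (N + 1), cone R N (Φ.flow r z i).1 (Φ.flow r z j).1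
        then 1 + ‖(Φ.flow r z i).2‖ ^ 2 else 0)) ∂(localGibbsLaw σ a₀ u₀ θ₀ N Φ) ≤ ENNReal.ofReal η') :
    ∫⁻ z, ENNReal.ofReal (∫ r in s..(s + w), ∑ i : Fin (N + 1),
      (if c * ρs ((Φ.flow r z i).1) < ((N : ℝ) + 1)⁻¹ * ∑ j : Fin (N + 1), cone R N (Φ.flow r z i).1 (Φ.flow r z j).1
        then 1 + ‖(Φ.flow r z i).2‖ ^ 2 else 0)) ∂(localGibbsLaw σ a₀ u₀ θ₀ N Φ) ≤
      ENNReal.ofReal (w * ((N : ℝ) + 1) * η') := by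
  haveI := sFinite_localGibbsLaw (a₀ := a₀) (θ₀ := θ₀) (u₀ := u₀) Φ
  have hN : (0 : ℝ) ≤ ((N : ℝ) + 1)⁻¹ := by positivity
  -- the frozen-threshold content is a measurable one-time functional
  have hH : Measurable fun y : Config (N + 1) (Fin 3) T3 => ∑ i : Fin (N + 1),
      (if c * ρs (y i).1 < ((N : ℝ) + 1)⁻¹ * ∑ j : Fin (N + 1), cone R N (y i).1 (y j).1 then 1 + ‖(y i).2‖ ^ 2 else 0) := by
    refine Finset.measurable_sum _ fun i _ => Measurable.ite ?_ ?_ measurable_const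
    · exact measurableSet_lt ((hρsm.comp (measurable_pi_apply i).fst).const_mul c)
        ((Finset.measurable_sum _ fun j _ => measurable_cone_comp R N (measurable_pi_apply i).fst
          (measurable_pi_apply j).fst).const_mul _)
    · exact measurable_const.add ((measurable_pi_apply i).snd.norm.pow_const 2)
  refine lintegral_ofReal_intervalIntegral_flow_le_of_normalised Φ (ae_mem_good_localGibbsLaw σ a₀ θ₀ u₀ N Φ) hH hw
    fun r hr => (lintegral_mono fun z => ?_).trans (hDKC r hr)
  -- threshold monotonicity, termwise
  refine ENNReal.ofReal_le_ofReal (mul_le_mul_of_nonneg_left (Finset.sum_le_sum fun i _ => ?_) hN)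
  exact ite_lt_le_ite_lt_of_le (hdock r hr _) (by positivity)

end TrueLaw

/-! ## The registered helper stub -/

/-- **Registered helper stub `stub_windowClauseFubini` (plan § 3 "window Fubini" of stub 4a-ii, skeleton v8, crux
stmt-17740)**: sorry-free conjunction of `lintegral_ofReal_intervalIntegral_flow_le` (§ 1), `ect_window_le` and
`denseKineticContent_window_le` (§ 2), restated with fully qualified names (the registered one-line signature). -/
theorem stub_windowClauseFubini : (∀ (σ : ℝ) (N : ℕ) (Φ : Literature.Analysis.FluidPDE.HardSphereFlow (Literature.Analysis.FluidPDE.Torus.geometry (Fin 3)) (Literature.MathematicalPhysics.KineticTheory.hsDiameter σ N) (N + 1)) (P : MeasureTheory.Measure (Literature.Analysis.FluidPDE.Config (N + 1) (Fin 3) Literature.MathematicalPhysics.KineticTheory.T3)) [MeasureTheory.SFinite P], (∀ᵐ z ∂P, z ∈ Φ.good) → ∀ (G : Literature.Analysis.FluidPDE.Config (N + 1) (Fin 3) Literature.MathematicalPhysics.KineticTheory.T3 → ℝ), Measurable G → ∀ (s w : ℝ), 0 ≤ w → ∀ (B : ENNReal), (∀ r ∈ Set.Icc s (s + w), ∫⁻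 z, ENNReal.ofReal (G (Φ.flow r z)) ∂P ≤ B) → ∫⁻ z, ENNReal.ofReal (∫ r in s..(s + w), G (Φ.flow r z)) ∂P ≤ ENNReal.ofReal w * B) ∧ (∀ (σ : ℝ) (N : ℕ) (Φ : Literature.Analysis.FluidPDE.HardSphereFlow (Literature.Analysis.FluidPDE.Torus.geometry (Fin 3)) (Literature.MathematicalPhysics.KineticTheory.hsDiameter σ N) (N + 1)) (a₀ θ₀ : Literature.MathematicalPhysics.KineticTheory.T3 → ℝ) (u₀ : Literature.MathematicalPhysics.KineticTheory.T3 → Literature.MathematicalPhysics.KineticTheory.V3) (M s w ε : ℝ), 0 ≤ w → (∀ r ∈ Set.Icc s (s + w), ∫⁻ z, ENNReal.ofReal (((N : ℝ) + 1)⁻¹ * ∑ i : Fin (N + 1), Set.indicator {v : Literature.MathematicalPhysics.KineticTheory.V3 | M < ‖v‖} (fun v => ‖v‖ ^ 3) ((Φ.flow r z i).2)) ∂(Literature.MathematicalPhysics.KineticTheory.localGibbsLaw σ a₀ u₀ θ₀ N Φ) ≤ ENNReal.ofReal ε) → ∫⁻ z, ENNReal.ofReal (∫ r in s..(s + w), ∑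 i : Fin (N + 1), Set.indicator {v : Literature.MathematicalPhysics.KineticTheory.V3 | M < ‖v‖} (fun v => ‖v‖ ^ 3) ((Φ.flow r z i).2)) ∂(Literature.MathematicalPhysics.KineticTheory.localGibbsLaw σ a₀ u₀ θ₀ N Φ) ≤ ENNReal.ofReal (w * ((N : ℝ) + 1) * ε)) ∧ (∀ (σ : ℝ) (N : ℕ) (Φ : Literature.Analysis.FluidPDE.HardSphereFlow (Literature.Analysis.FluidPDE.Torus.geometry (Fin 3)) (Literature.MathematicalPhysics.KineticTheory.hsDiameter σ N) (N + 1)) (a₀ θ₀ : Literature.MathematicalPhysics.KineticTheory.T3 → ℝ) (u₀ : Literature.MathematicalPhysics.KineticTheory.T3 → Literature.MathematicalPhysics.KineticTheory.V3) (ρ : ℝ → Literature.MathematicalPhysics.KineticTheory.T3 → ℝ) (ρs : Literature.MathematicalPhysics.KineticTheory.T3 → ℝ), Measurable ρs → ∀ (c R s w η' : ℝ), 0 ≤ w → (∀ r ∈ Set.Icc s (s + w), ∀ y, 5 / 4 * ρ r y ≤ c * ρs y) → (∀ r ∈ Set.Icc s (s + w), ∫⁻ z, ENNReal.ofReal (((N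 : ℝ) + 1)⁻¹ * ∑ i : Fin (N + 1), (if 5 / 4 * ρ r ((Φ.flow r z i).1) < ((N : ℝ) + 1)⁻¹ * ∑ j : Fin (N + 1), Summit.AtomisticToContinuum.HydrodynamicLimit.Theorems.LTEInBand.cone R N (Φ.flow r z i).1 (Φ.flow r z j).1 then 1 + ‖(Φ.flow r z i).2‖ ^ 2 else 0)) ∂(Literature.MathematicalPhysics.KineticTheory.localGibbsLaw σ a₀ u₀ θ₀ N Φ) ≤ ENNReal.ofReal η') → ∫⁻ z, ENNReal.ofReal (∫ r in s..(s + w), ∑ i : Fin (N + 1), (if c * ρs ((Φ.flow r z i).1) < ((N : ℝ) + 1)⁻¹ * ∑ j : Fin (N + 1), Summit.AtomisticToContinuum.HydrodynamicLimit.Theorems.LTEInBand.cone R N (Φ.flow r z i).1 (Φ.flow r z j).1 then 1 + ‖(Φ.flow r z i).2‖ ^ 2 else 0)) ∂(Literature.MathematicalPhysics.KineticTheory.localGibbsLaw σ a₀ u₀ θ₀ N Φ) ≤ ENNReal.ofReal (w * ((N : ℝ) + 1) * η')) :=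
  ⟨fun _ _ Φ _ _ hgood _ hG _ _ hw _ hB => lintegral_ofReal_intervalIntegral_flow_le Φ hgood hG hw hB,
    fun _ _ Φ _ _ _ _ _ _ _ hw hECT => ect_window_le Φ hw hECT,
    fun _ _ Φ _ _ _ _ _ hρsm _ _ _ _ _ hw hdock hDKC => denseKineticContent_window_le Φ hρsm hw hdock hDKC⟩

end Summit.AtomisticToContinuum.HydrodynamicLimit.Theorems.LTEInBand

end
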